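import Summits.HodgeConjecture.HodgeConjecture.Theorems.R90S6BCPartnerPairRecursion  -- FILE A (R1)(R2) (brings ★ W10-c (B.1′)(B.2), ★ W10-g (H.4))
import Summits.HodgeConjecture.HodgeConjecture.Theorems.R90S6MacdonaldRankOne         -- ★ W8-g square law `doubleCosetOperator_torusGen_mul_self`, `torusGen_eq_basic`, `natCast_sqrt_card_sub_one`
import Mathlib.Tactic.Module
import HarnessLib

/-!
# R90 · S6 «Ch. 14.1–14.5 stable TF» — card W10-h (h.1′)+API, FILE C: THE ROWS `(1,0)`, `(1,1)`, `(2,0)`, `(2,1)`, `(2,2)` OF THE β-TABLE,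
# KERNEL-CHECKED (`Theorems/R90S6BCPartnerShellRows.lean`; row E1.4.4.2.3)

Cell `hodgecm-mathlib`, crux H413 (`stmt-HodgeConjecture-24833`), route of record `HCCMUnconditional`; programme R90-TF, section S6 (base `R90-C14`),
seat K2Liu-p27 (g4) (cross-line hand, chair K2-lead VALVE 14, 2026-09-05T01:49:33Z); S6 dealer R90-C14-plan (g2) RE-SCOPE of card W10-h (R90 bus
01:48:30Z, GO 01:54:52Z): «(i) SHELL∕TOP-COEFFICIENT THEOREM `b(c_{(a,b,0)}) ∈ Φ_a + span_ℂ{Φ_k : k < a}` by induction on `a` over ★ (H.3) + ★ W10-c +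
★ U(3) three-term law, (ii) `bT₃ = 1` central reduction (★), (iii) the recursion restated as the public API with the β-table rows (1,0)…(2,2) as named corollaries».
Lane `--supports stmt-HodgeConjecture-24833 --as helper`; THEOREMS ONLY (no definition, no instance, no notation, no named fact, no `sorry`).
This is FILE C of three (A `R90S6BCPartnerPairRecursion`: the recursion (R1)(R2); B `R90S6BCPartnerShell`: the shell ∕ top-coefficient theorem).

LETTERS (`GL₃` side, VERBATIM as ★ W10-c∕W10-g): generic DVR field `K` (`hϖ`, `hu : u² = q`, `hwt`), `q = #𝓀[K]`, `c_ν := 1_{K₀ ϖ^ν K₀} =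
doubleCosetOperator (glInt 3 K) (zpowDiagGL ν)`, `T₁ = 1_{K₀ diag(ϖ,1,1) K₀}`, `b := bcGraphPartnerAlgHom …` (print's `ψ̂_G`), `B_ν := b(c_ν)`, and the two-parameter
family `B_{a,b} := B_{(a,b,0)}`, written `![(a : ℤ), (b : ℤ), 0]` with `a b : ℕ` (`B_ν` only depends on `ν` mod `𝟙`, ★ (H.4.c)).
`U(3)` side as ★ (B.1′): any unramified datum `hd : UnramifiedLocalConjDatum σ_w ϖ'` at the inert place `w`, `t = hd.torusGen = diag(ϖ',1,ϖ'⁻¹)`,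
`Φ_m := 1_{K₀ tᵐ K₀} = doubleCosetOperator (unitaryInt σ_w J₀) (hd.torusGen ^ m)`, `Q = #𝓀[E_w]`, `√Q = Nat.sqrt Q` (`√Q·√Q = Q`, ★ `sqrt_card_residueField_mul_self`),
and the junction identity `hqQ : (#𝓀[K] : ℂ) = Q` (discharged at `K = E_w` by ★ `natCard_residueField_eq_of_compatible`).

WHAT IS PROVED (`Φ₁ = 1_{K₀ t K₀}`, `Φ₂ = 1_{K₀ t² K₀}`): **`bcGraphPartnerAlgHom_cartan_pair_one_zero`**, **`_one_one`**: `B_{1,0} = B_{1,1} = Φ₁ + (Q − √Q + 1)•1`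
(kill-check = ★ (B.1′)(B.2)); **`_two_zero`**, **`_two_two`**: `B_{2,0} = B_{2,2} = Φ₂ + (Q − √Q)•Φ₁ + (Q² − Q√Q + Q)•1`; **`_two_one`**:
`B_{2,1} = Φ₂ + (2Q − √Q + 1)•Φ₁ + (Q² − 2Q√Q + 2Q − √Q)•1` — FILE A's (R1)∕(R2) at `a = 1`, the square law ★ W8-g, `√Q·√Q = Q`, assembled by a light-carrier
row engine (§1).  `B_{a,b} = B_{a,a−b}` (`λ_{(z,1,z⁻¹)}` is blind to `ν ↦ −rev ν`): the banked script table `R90/R90-C14-p10/g0/W10h_beta_table.txt` is wrong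
in row (2,2) (dealer ruling 2026-09-05T01:54:52Z: demoted to rows (1,0)…(2,1)); rows (1,0)–(2,1) there agree with these kernel rows.
HONEST LABEL: local Hecke bookkeeping for E1.4.4.2.3, count-neutral until the BC identity consumes it; HC_CM is proved only modulo the 7 printed citations
(2 remaining named inputs: hLiu418 = stmt-HodgeConjecture-24832, h413 = stmt-HodgeConjecture-24833) until rung 0 closes; REL ≠ ★ ≠ BUILT.

## References
* [Rogawski1990] J. D. Rogawski, *Automorphic Representations of Unitary Groups in Three Variables*, Ann. of Math. Stud. 123 (1990), §4.10 Prop. 4.10.2 p. 58.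
* [Macdonald1995] I. G. Macdonald, *Symmetric Functions and Hall Polynomials*, 2nd ed. (1995), Ch. II (4.6), Ch. V (2.5)–(2.6).
* [Macdonald1971] I. G. Macdonald, *Spherical functions on a group of p-adic type* (1971), Ch. V §3.
* [CartierCorvallis1979] P. Cartier, *Representations of 𝔭-adic groups: a survey*, PSPM 33.1 (1979), §IV (4.2), Thm. 4.1, Cor. 4.2.
-/

set_option autoImplicit false
-- the mandated namespace repeats the single-problem summit's segment (`HodgeConjecture.HodgeConjecture`)
set_option linter.dupNamespace false

noncomputable section

open MulAction
open NumberField IsDedekindDomain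
open Literature.NumberTheory.Automorphic Literature.NumberTheory.Automorphic.HermitianLattice Literature.NumberTheory.Automorphic.UnitaryGroup
open Literature.NumberTheory.Automorphic.CartanUnique
open scoped MatrixGroups
open ValuativeRel

namespace Summit.HodgeConjecture.HodgeConjecture.R90.S6

universe u

/-! ## §1 The light-carrier row engine -/

section Engine

variable {H : Type*} [Semiring H] [Algebra ℂ H]

/-- **ROW ENGINE (a = 2).**  From the square law, `P = P' = T = Φ₁ + c • 1` and a recursion identity `P · T = B₂ + N • P'`, the explicit shell expansion
`B₂ = Φ₂ + (s + 2c − N) • Φ₁ + (t + c² − Nc) • 1` (light carriers; the scalar identities are supplied as hypotheses so that nothing is rewritten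
on the heavy side). [cite: Macdonald1971, Ch. V §3] [cite: Macdonald1995, Ch. V (2.6)] -/
private theorem row_engine_add_smul [IsRightCancelAdd H] {P P' T B₂ Φ₁ Φ₂ : H} {s' t' c N X Y : ℂ}
    (hsq' : Φ₁ * Φ₁ = Φ₂ + s' • Φ₁ + t' • 1) (hP : P = Φ₁ + c • 1) (hT : T = Φ₁ + c • 1) (hP' : P' = Φ₁ + c • 1)
    (h : P * T = B₂ + N • P') (hX : s' + 2 * c - N = X) (hY : t' + c * c - N * c = Y) : B₂ = Φ₂ + X • Φ₁ + Y • 1 := by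
  subst hX hY
  apply add_right_cancel (b := N • P')
  rw [← h, hP, hT, hP']
  simp only [add_mul, mul_add, smul_mul_assoc, mul_smul_comm, one_mul, mul_one, smul_add, smul_smul, hsq']
  module

/-- Row engine, variant `P · T = N • P' + B₂` (the diagonal recursion lists the lower term first). [cite: Macdonald1971, Ch. V §3] -/
private theorem row_engine_smul_add [IsRightCancelAdd H] {P P' T B₂ Φ₁ Φ₂ : H} {s' t' c N X Y : ℂ}
    (hsq' : Φ₁ * Φ₁ = Φ₂ + s' • Φ₁ + t' • 1) (hP : P = Φ₁ + c • 1) (hT : T = Φ₁ + c • 1) (hP' : P' = Φ₁ + c • 1)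
    (h : P * T = N • P' + B₂) (hX : s' + 2 * c - N = X) (hY : t' + c * c - N * c = Y) : B₂ = Φ₂ + X • Φ₁ + Y • 1 :=
  row_engine_add_smul hsq' hP hT hP' (h.trans (add_comm _ _)) hX hY

/-- Row engine, variant `P · T = B₂ + N • E` with `E = 1` (the lower term is central). [cite: Macdonald1971, Ch. V §3] -/
private theorem row_engine_add_smul_one [IsRightCancelAdd H] {P T B₂ E Φ₁ Φ₂ : H} {s' t' c N X Y : ℂ}
    (hsq' : Φ₁ * Φ₁ = Φ₂ + s' • Φ₁ + t' • 1) (hP : P = Φ₁ + c • 1) (hT : T = Φ₁ + c • 1) (hE : E = 1)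
    (h : P * T = B₂ + N • E) (hX : s' + 2 * c = X) (hY : t' + c * c - N = Y) : B₂ = Φ₂ + X • Φ₁ + Y • 1 := by
  subst hX hY
  apply add_right_cancel (b := N • E)
  rw [← h, hP, hT, hE]
  simp only [add_mul, mul_add, smul_mul_assoc, mul_smul_comm, one_mul, mul_one, smul_add, smul_smul, hsq']
  module

end Engine

section Shell

variable {F E : Type} [Field F] [NumberField F] [Field E] [NumberField E] [Algebra F E] [Algebra.IsQuadraticExtension F E]
  (c : E ≃ₐ[F] E) (hc1 : c ≠ 1) (v : HeightOneSpectrum (𝓞 F)) (w : PlacesOver E v) (hw : c • w.1 = w.1)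
  (hv : Algebra.IsUnramifiedIn (𝓞 E) v.asIdeal)
  {K : Type u} [Field K] [ValuativeRel K] [IsDiscreteValuationRing 𝒪[K]] [Finite 𝓀[K]] {ϖ : K}
  [IsHeckeTriple (⊤ : Submonoid (GL (Fin 3) K)) (glInt 3 K) (glInt 3 K)]
  (hϖ : IsUniformizingElement ϖ) {u : ℂˣ} (hu : (u : ℂ) ^ 2 = ((Nat.card 𝓀[K] : ℕ) : ℂ))
  {wt : Multiplicative (Fin 3 → ℤ) →* ℂ}
  (hwt : ∀ e : Fin 3 → ℤ, wt (Multiplicative.ofAdd e) = ((u ^ ((((3 : ℕ) : ℤ) - 1) * (∑ i, e i) - 2 * satakeTwistExp e) : ℂˣ) : ℂ))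

/-! ## §4 The rows `(1,0)`, `(1,1)`, `(2,0)`, `(2,1)`, `(2,2)` of the β-table, kernel-checked -/

/-- `(1,0,0) = e₀`. [folklore] -/
private theorem vec_one_zero_zero : (![1, 0, 0] : Fin 3 → ℤ) = Pi.single 0 1 := by
  funext i; fin_cases i <;> simp

/-- `(1,1,0) = 𝟙 − e₂`. [folklore] -/
private theorem vec_one_one_zero : (![1, 1, 0] : Fin 3 → ℤ) = 1 - Pi.single 2 1 := by
  funext i; simp only [Pi.sub_apply, Pi.one_apply]; fin_cases i <;> simp

/-- `(0,0,0) = 0`. [folklore] -/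
private theorem vec_zero_zero_zero : (![0, 0, 0] : Fin 3 → ℤ) = 0 := by
  funext i; fin_cases i <;> simp

/-- ★ (B.1′) with the `U(3)` operator written `1_{K₀ t K₀}`, `t = hd.torusGen`. [cite: Rogawski1990, §4.10 Prop. 4.10.2 p. 58] [cite: CartierCorvallis1979, §IV (4.2), Cor. 4.2] -/
private theorem bcGraphPartnerAlgHom_heckeDiag_one_eq_torusGen {ϖ' : w.1.adicCompletion E}
    (hd : UnramifiedLocalConjDatum (galAdicCompletionMap (L := E) c hw) ϖ')
    (hqQ : ((Nat.card 𝓀[K] : ℕ) : ℂ) = (Nat.card (Valued.ResidueField (w.1.adicCompletion E)) : ℂ)) :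
    haveI := isHeckeTriple_unitaryInt_adicCompletion c v w hw ((StdForm.antidiagonal 3).over (w.1.adicCompletion E))
    bcGraphPartnerAlgHom c hc1 v w hw hv hϖ hu hwt (heckeAlgebra.doubleCosetOperator (glInt 3 K) (heckeDiag 3 (Units.mk0 ϖ hϖ.ne_zero) 1)) =
      heckeAlgebra.doubleCosetOperator (unitaryInt (galAdicCompletionMap (L := E) c hw) ((StdForm.antidiagonal 3).over (w.1.adicCompletion E))) hd.torusGen + ((Nat.card (Valued.ResidueField (w.1.adicCompletion E)) : ℂ) - (Nat.sqrt (Nat.card (Valued.ResidueField (w.1.adicCompletion E))) : ℂ) + 1) • 1 := by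
  haveI := isHeckeTriple_unitaryInt_adicCompletion c v w hw ((StdForm.antidiagonal 3).over (w.1.adicCompletion E))
  have e := congrArg (fun g => heckeAlgebra.doubleCosetOperator (k := ℂ) (unitaryInt (galAdicCompletionMap (L := E) c hw) ((StdForm.antidiagonal 3).over (w.1.adicCompletion E))) g) (torusGen_eq_basic hd)
  exact (bcGraphPartnerAlgHom_heckeDiag_one_eq_basic c hc1 v w hw hv hϖ hu hwt hd hqQ).trans (congrArg (· + _) e.symm)

/-- **ROW (1,0): `B_{1,0} = Φ₁ + (Q − √Q + 1) • 1`** — kill-check = ★ (B.1′) (`c_{(1,0,0)} = T₁`). [cite: Rogawski1990, §4.10 Prop. 4.10.2 p. 58] [cite: CartierCorvallis1979, §IV Cor. 4.2] -/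
theorem bcGraphPartnerAlgHom_cartan_pair_one_zero {ϖ' : w.1.adicCompletion E}
    (hd : UnramifiedLocalConjDatum (galAdicCompletionMap (L := E) c hw) ϖ')
    (hqQ : ((Nat.card 𝓀[K] : ℕ) : ℂ) = (Nat.card (Valued.ResidueField (w.1.adicCompletion E)) : ℂ)) :
    haveI := isHeckeTriple_unitaryInt_adicCompletion c v w hw ((StdForm.antidiagonal 3).over (w.1.adicCompletion E))
    bcGraphPartnerAlgHom c hc1 v w hw hv hϖ hu hwt (heckeAlgebra.doubleCosetOperator (glInt 3 K) (zpowDiagGL hϖ.ne_zero ![1, 0, 0])) =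
      heckeAlgebra.doubleCosetOperator (unitaryInt (galAdicCompletionMap (L := E) c hw) ((StdForm.antidiagonal 3).over (w.1.adicCompletion E))) hd.torusGen + ((Nat.card (Valued.ResidueField (w.1.adicCompletion E)) : ℂ) - (Nat.sqrt (Nat.card (Valued.ResidueField (w.1.adicCompletion E))) : ℂ) + 1) • 1 :=
  (congrArg (fun ν' : Fin 3 → ℤ => bcGraphPartnerAlgHom c hc1 v w hw hv hϖ hu hwt (heckeAlgebra.doubleCosetOperator (glInt 3 K) (zpowDiagGL hϖ.ne_zero ν'))) vec_one_zero_zero).trans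
    ((bcGraphPartnerAlgHom_cartan_single_zero c hc1 v w hw hv hϖ hu hwt).trans (bcGraphPartnerAlgHom_heckeDiag_one_eq_torusGen c hc1 v w hw hv hϖ hu hwt hd hqQ))

/-- **ROW (1,1): `B_{1,1} = Φ₁ + (Q − √Q + 1) • 1`** — kill-check = ★ (B.2) (`c_{(1,1,0)} = T₂`, `bT₂ = bT₁`). [cite: Rogawski1990, §4.10 Prop. 4.10.2 p. 58] [cite: CartierCorvallis1979, §IV Cor. 4.2] -/
theorem bcGraphPartnerAlgHom_cartan_pair_one_one {ϖ' : w.1.adicCompletion E}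
    (hd : UnramifiedLocalConjDatum (galAdicCompletionMap (L := E) c hw) ϖ')
    (hqQ : ((Nat.card 𝓀[K] : ℕ) : ℂ) = (Nat.card (Valued.ResidueField (w.1.adicCompletion E)) : ℂ)) :
    haveI := isHeckeTriple_unitaryInt_adicCompletion c v w hw ((StdForm.antidiagonal 3).over (w.1.adicCompletion E))
    bcGraphPartnerAlgHom c hc1 v w hw hv hϖ hu hwt (heckeAlgebra.doubleCosetOperator (glInt 3 K) (zpowDiagGL hϖ.ne_zero ![1, 1, 0])) =
      heckeAlgebra.doubleCosetOperator (unitaryInt (galAdicCompletionMap (L := E) c hw) ((StdForm.antidiagonal 3).over (w.1.adicCompletion E))) hd.torusGen + ((Nat.card (Valued.ResidueField (w.1.adicCompletion E)) : ℂ) - (Nat.sqrt (Nat.card (Valued.ResidueField (w.1.adicCompletion E))) : ℂ) + 1) • 1 :=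
  (congrArg (fun ν' : Fin 3 → ℤ => bcGraphPartnerAlgHom c hc1 v w hw hv hϖ hu hwt (heckeAlgebra.doubleCosetOperator (glInt 3 K) (zpowDiagGL hϖ.ne_zero ν'))) vec_one_one_zero).trans
    ((bcGraphPartnerAlgHom_cartan_one_sub_single_two c hc1 v w hw hv hϖ hu hwt).trans
      (bcGraphPartnerAlgHom_heckeDiag_one_eq_torusGen c hc1 v w hw hv hϖ hu hwt hd hqQ))

omit [NumberField F] [Algebra.IsQuadraticExtension F E] in
include hc1 in
/-- ★ W8-g square law, restated in this file's letters (`σ_w ≠ id` from `c ≠ 1`). [cite: Macdonald1971, Ch. V §3] -/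
private theorem doubleCosetOperator_torusGen_mul_torusGen {ϖ' : w.1.adicCompletion E}
    (hd : UnramifiedLocalConjDatum (galAdicCompletionMap (L := E) c hw) ϖ') :
    haveI := isHeckeTriple_unitaryInt_adicCompletion c v w hw ((StdForm.antidiagonal 3).over (w.1.adicCompletion E))
    heckeAlgebra.doubleCosetOperator (k := ℂ) (unitaryInt (galAdicCompletionMap (L := E) c hw) ((StdForm.antidiagonal 3).over (w.1.adicCompletion E))) hd.torusGen * heckeAlgebra.doubleCosetOperator (unitaryInt (galAdicCompletionMap (L := E) c hw) ((StdForm.antidiagonal 3).over (w.1.adicCompletion E))) hd.torusGen =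
      heckeAlgebra.doubleCosetOperator (unitaryInt (galAdicCompletionMap (L := E) c hw) ((StdForm.antidiagonal 3).over (w.1.adicCompletion E))) (hd.torusGen ^ 2) +
        ((Nat.sqrt (Nat.card (Valued.ResidueField (w.1.adicCompletion E))) - 1 : ℕ) : ℂ) • heckeAlgebra.doubleCosetOperator (unitaryInt (galAdicCompletionMap (L := E) c hw) ((StdForm.antidiagonal 3).over (w.1.adicCompletion E))) hd.torusGen +
        ((Nat.card (Valued.ResidueField (w.1.adicCompletion E)) ^ 2 + Nat.sqrt (Nat.card (Valued.ResidueField (w.1.adicCompletion E))) : ℕ) : ℂ) • 1 := by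
  haveI := isHeckeTriple_unitaryInt_adicCompletion c v w hw ((StdForm.antidiagonal 3).over (w.1.adicCompletion E))
  haveI := Literature.NumberTheory.Automorphic.finite_residueField_adicCompletion E w.1
  exact doubleCosetOperator_torusGen_mul_self hd (exists_galAdicCompletionMap_ne c hc1 v w hw)

/-- **ROW (2,0): `B_{2,0} = Φ₂ + (Q − √Q) • Φ₁ + (Q² − Q√Q + Q) • 1`** — (R1) at `(1,0)`: `B_{1,0}·bT₁ = B_{2,0} + (q+1)•B_{1,1}`, with rows (1,0),(1,1), the square law
and `hqQ`; kill-check: agrees with the banked table row (2,0) `(s⁴−s³+s² | s²−s | 1)`, `s = √Q`. [cite: Rogawski1990, §4.10 Prop. 4.10.2 p. 58] [cite: Macdonald1995, Ch. V (2.6)] -/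
theorem bcGraphPartnerAlgHom_cartan_pair_two_zero {ϖ' : w.1.adicCompletion E}
    (hd : UnramifiedLocalConjDatum (galAdicCompletionMap (L := E) c hw) ϖ')
    (hqQ : ((Nat.card 𝓀[K] : ℕ) : ℂ) = (Nat.card (Valued.ResidueField (w.1.adicCompletion E)) : ℂ)) :
    haveI := isHeckeTriple_unitaryInt_adicCompletion c v w hw ((StdForm.antidiagonal 3).over (w.1.adicCompletion E))
    bcGraphPartnerAlgHom c hc1 v w hw hv hϖ hu hwt (heckeAlgebra.doubleCosetOperator (glInt 3 K) (zpowDiagGL hϖ.ne_zero ![2, 0, 0])) =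
      heckeAlgebra.doubleCosetOperator (unitaryInt (galAdicCompletionMap (L := E) c hw) ((StdForm.antidiagonal 3).over (w.1.adicCompletion E))) (hd.torusGen ^ 2) + ((Nat.card (Valued.ResidueField (w.1.adicCompletion E)) : ℂ) - (Nat.sqrt (Nat.card (Valued.ResidueField (w.1.adicCompletion E))) : ℂ)) • heckeAlgebra.doubleCosetOperator (unitaryInt (galAdicCompletionMap (L := E) c hw) ((StdForm.antidiagonal 3).over (w.1.adicCompletion E))) hd.torusGen +
        ((Nat.card (Valued.ResidueField (w.1.adicCompletion E)) : ℂ) ^ 2 - (Nat.card (Valued.ResidueField (w.1.adicCompletion E)) : ℂ) * (Nat.sqrt (Nat.card (Valued.ResidueField (w.1.adicCompletion E))) : ℂ) + (Nat.card (Valued.ResidueField (w.1.adicCompletion E)) : ℂ)) • 1 := by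
  have h := bcGraphPartnerAlgHom_cartan_pair_mul_heckeDiag_one c hc1 v w hw hv hϖ hu hwt (a := 1) (b := 0) (Nat.zero_le 1)
  simp only [if_pos (show 0 + 1 ≤ 1 by omega), if_pos (show True from trivial), if_neg (show ¬ 1 ≤ 0 by omega), zero_smul, add_zero] at h
  simp only [Nat.cast_one, Nat.cast_zero, one_add_one_eq_two, zero_add] at h
  haveI := Literature.NumberTheory.Automorphic.finite_residueField_adicCompletion E w.1
  have hs : (Nat.sqrt (Nat.card (Valued.ResidueField (w.1.adicCompletion E))) : ℂ) *
      (Nat.sqrt (Nat.card (Valued.ResidueField (w.1.adicCompletion E))) : ℂ) = (Nat.card (Valued.ResidueField (w.1.adicCompletion E)) : ℂ) := by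
    exact_mod_cast hd.sqrt_card_residueField_mul_self (exists_galAdicCompletionMap_ne c hc1 v w hw)
  refine row_engine_add_smul (doubleCosetOperator_torusGen_mul_torusGen c hc1 v w hw hd)
    (bcGraphPartnerAlgHom_cartan_pair_one_zero c hc1 v w hw hv hϖ hu hwt hd hqQ) (bcGraphPartnerAlgHom_heckeDiag_one_eq_torusGen c hc1 v w hw hv hϖ hu hwt hd hqQ)
    (bcGraphPartnerAlgHom_cartan_pair_one_one c hc1 v w hw hv hϖ hu hwt hd hqQ) h ?_ ?_
  · rw [natCast_sqrt_card_sub_one]; push_cast; rw [hqQ]; ring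
  · push_cast; rw [hqQ]; linear_combination hs

/-- **ROW (2,1): `B_{2,1} = Φ₂ + (2Q − √Q + 1) • Φ₁ + (Q² − 2Q√Q + 2Q − √Q) • 1`** — (R1) at `(1,1)`: `B_{1,1}·bT₁ = B_{2,1} + (q² + q + 1)•B_{0,0}`, `B_{0,0} = 1`;
kill-check: agrees with the banked table row (2,1) `(s⁴−2s³+2s²−s | 2s²−s+1 | 1)`. [cite: Rogawski1990, §4.10 Prop. 4.10.2 p. 58] [cite: Macdonald1995, Ch. V (2.6)] -/
theorem bcGraphPartnerAlgHom_cartan_pair_two_one {ϖ' : w.1.adicCompletion E}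
    (hd : UnramifiedLocalConjDatum (galAdicCompletionMap (L := E) c hw) ϖ')
    (hqQ : ((Nat.card 𝓀[K] : ℕ) : ℂ) = (Nat.card (Valued.ResidueField (w.1.adicCompletion E)) : ℂ)) :
    haveI := isHeckeTriple_unitaryInt_adicCompletion c v w hw ((StdForm.antidiagonal 3).over (w.1.adicCompletion E))
    bcGraphPartnerAlgHom c hc1 v w hw hv hϖ hu hwt (heckeAlgebra.doubleCosetOperator (glInt 3 K) (zpowDiagGL hϖ.ne_zero ![2, 1, 0])) =
      heckeAlgebra.doubleCosetOperator (unitaryInt (galAdicCompletionMap (L := E) c hw) ((StdForm.antidiagonal 3).over (w.1.adicCompletion E))) (hd.torusGen ^ 2) + (2 * (Nat.card (Valued.ResidueField (w.1.adicCompletion E)) : ℂ) - (Nat.sqrt (Nat.card (Valued.ResidueField (w.1.adicCompletion E))) : ℂ) + 1) • heckeAlgebra.doubleCosetOperator (unitaryInt (galAdicCompletionMap (L := E) c hw) ((StdForm.antidiagonal 3).over (w.1.adicCompletion E))) hd.torusGen +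
        ((Nat.card (Valued.ResidueField (w.1.adicCompletion E)) : ℂ) ^ 2 - 2 * (Nat.card (Valued.ResidueField (w.1.adicCompletion E)) : ℂ) * (Nat.sqrt (Nat.card (Valued.ResidueField (w.1.adicCompletion E))) : ℂ) + 2 * (Nat.card (Valued.ResidueField (w.1.adicCompletion E)) : ℂ) - (Nat.sqrt (Nat.card (Valued.ResidueField (w.1.adicCompletion E))) : ℂ)) • 1 := by
  have h := bcGraphPartnerAlgHom_cartan_pair_mul_heckeDiag_one c hc1 v w hw hv hϖ hu hwt (a := 1) (b := 1) le_rfl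
  simp only [if_neg (show ¬ 1 + 1 ≤ 1 by omega), if_pos (show 1 ≤ 1 by omega), if_pos (show True from trivial), and_self,
    zero_smul, add_zero] at h
  simp only [Nat.cast_one, one_add_one_eq_two, sub_self] at h
  haveI := Literature.NumberTheory.Automorphic.finite_residueField_adicCompletion E w.1
  have hs : (Nat.sqrt (Nat.card (Valued.ResidueField (w.1.adicCompletion E))) : ℂ) *
      (Nat.sqrt (Nat.card (Valued.ResidueField (w.1.adicCompletion E))) : ℂ) = (Nat.card (Valued.ResidueField (w.1.adicCompletion E)) : ℂ) := by
    exact_mod_cast hd.sqrt_card_residueField_mul_self (exists_galAdicCompletionMap_ne c hc1 v w hw)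
  have hE : bcGraphPartnerAlgHom c hc1 v w hw hv hϖ hu hwt (heckeAlgebra.doubleCosetOperator (glInt 3 K) (zpowDiagGL hϖ.ne_zero ![0, 0, 0])) = 1 :=
    (congrArg (fun ν' : Fin 3 → ℤ => bcGraphPartnerAlgHom c hc1 v w hw hv hϖ hu hwt (heckeAlgebra.doubleCosetOperator (glInt 3 K) (zpowDiagGL hϖ.ne_zero ν'))) vec_zero_zero_zero).trans
      (bcGraphPartnerAlgHom_cartan_zero c hc1 v w hw hv hϖ hu hwt)
  refine row_engine_add_smul_one (doubleCosetOperator_torusGen_mul_torusGen c hc1 v w hw hd)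
    (bcGraphPartnerAlgHom_cartan_pair_one_one c hc1 v w hw hv hϖ hu hwt hd hqQ) (bcGraphPartnerAlgHom_heckeDiag_one_eq_torusGen c hc1 v w hw hv hϖ hu hwt hd hqQ)
    hE h ?_ ?_
  · rw [natCast_sqrt_card_sub_one]; ring
  · push_cast; rw [hqQ]; linear_combination hs

/-- **ROW (2,2): `B_{2,2} = B_{2,0} = Φ₂ + (Q − √Q) • Φ₁ + (Q² − Q√Q + Q) • 1`** — (R2) at `a = 1`: `B_{1,1}·bT₁ = (q+1)•B_{1,0} + B_{2,2}`; the symmetry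
`B_{a,b} = B_{a,a−b}`.  NOTE: the banked script table `R90/R90-C14-p10/g0/W10h_beta_table.txt` lists a different row (2,2) — it is wrong there (dealer
ruling 2026-09-05T01:54:52Z: demoted to rows (1,0)…(2,1)); this kernel row is the record. [cite: Rogawski1990, §4.10 Prop. 4.10.2 p. 58] [cite: Macdonald1995, Ch. V (2.6)] -/
theorem bcGraphPartnerAlgHom_cartan_pair_two_two {ϖ' : w.1.adicCompletion E}
    (hd : UnramifiedLocalConjDatum (galAdicCompletionMap (L := E) c hw) ϖ')
    (hqQ : ((Nat.card 𝓀[K] : ℕ) : ℂ) = (Nat.card (Valued.ResidueField (w.1.adicCompletion E)) : ℂ)) :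
    haveI := isHeckeTriple_unitaryInt_adicCompletion c v w hw ((StdForm.antidiagonal 3).over (w.1.adicCompletion E))
    bcGraphPartnerAlgHom c hc1 v w hw hv hϖ hu hwt (heckeAlgebra.doubleCosetOperator (glInt 3 K) (zpowDiagGL hϖ.ne_zero ![2, 2, 0])) =
      heckeAlgebra.doubleCosetOperator (unitaryInt (galAdicCompletionMap (L := E) c hw) ((StdForm.antidiagonal 3).over (w.1.adicCompletion E))) (hd.torusGen ^ 2) + ((Nat.card (Valued.ResidueField (w.1.adicCompletion E)) : ℂ) - (Nat.sqrt (Nat.card (Valued.ResidueField (w.1.adicCompletion E))) : ℂ)) • heckeAlgebra.doubleCosetOperator (unitaryInt (galAdicCompletionMap (L := E) c hw) ((StdForm.antidiagonal 3).over (w.1.adicCompletion E))) hd.torusGen +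
        ((Nat.card (Valued.ResidueField (w.1.adicCompletion E)) : ℂ) ^ 2 - (Nat.card (Valued.ResidueField (w.1.adicCompletion E)) : ℂ) * (Nat.sqrt (Nat.card (Valued.ResidueField (w.1.adicCompletion E))) : ℂ) + (Nat.card (Valued.ResidueField (w.1.adicCompletion E)) : ℂ)) • 1 := by
  have h := bcGraphPartnerAlgHom_cartan_diag_mul_heckeDiag_one c hc1 v w hw hv hϖ hu hwt 1
  simp only [if_pos (show 1 ≤ 1 by omega), if_pos (show True from trivial)] at h
  simp only [Nat.cast_one, one_add_one_eq_two, sub_self] at h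
  haveI := Literature.NumberTheory.Automorphic.finite_residueField_adicCompletion E w.1
  have hs : (Nat.sqrt (Nat.card (Valued.ResidueField (w.1.adicCompletion E))) : ℂ) *
      (Nat.sqrt (Nat.card (Valued.ResidueField (w.1.adicCompletion E))) : ℂ) = (Nat.card (Valued.ResidueField (w.1.adicCompletion E)) : ℂ) := by
    exact_mod_cast hd.sqrt_card_residueField_mul_self (exists_galAdicCompletionMap_ne c hc1 v w hw)
  refine row_engine_smul_add (doubleCosetOperator_torusGen_mul_torusGen c hc1 v w hw hd)
    (bcGraphPartnerAlgHom_cartan_pair_one_one c hc1 v w hw hv hϖ hu hwt hd hqQ) (bcGraphPartnerAlgHom_heckeDiag_one_eq_torusGen c hc1 v w hw hv hϖ hu hwt hd hqQ)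
    (bcGraphPartnerAlgHom_cartan_pair_one_zero c hc1 v w hw hv hϖ hu hwt hd hqQ) h ?_ ?_
  · rw [natCast_sqrt_card_sub_one]; push_cast; rw [hqQ]; ring
  · push_cast; rw [hqQ]; linear_combination hs

end Shell

end Summit.HodgeConjecture.HodgeConjecture.R90.S6

end
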